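import Summits.QuantumFields.YangMills.Theorems.F4SubCurvatureDoorHarmonicSphere
import Literature.Algebra.Polynomial.LaplacianOrthogonalInvariance
import Literature.LinearAlgebra.UnisolventPoints
import Mathlib
import HarnessLib

/-!
# Route `F4SubCurvatureDoor`, crux ⟨stmt-QuantumFields-23125⟩ `RationalToGeneral`: LINE g18-A v5 — CSF build-plan brick C2(i)
# «symmetry transfers to every harmonic channel» (def-free)

Owner ym-idea-3 g18's build plan for the registered stub `stub_channelShellForm` (`Lines/sextic_channel_stubplans.md` §4) asks, as the
first half of C2 «TopChannelCoefficients»: if a kernel with a finite harmonic channel expansion `K(x) = Σ_k g_k(‖x‖²) H_k(x)` off the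
origin is invariant under a linear isometry `R` of `ℝ⁴`, then EACH degree channel with frozen radial argument,
`x ↦ Σ_{deg H_k = L} g_k(r²) H_k(x)`, is `R`-invariant (apply C1 — a harmonic polynomial vanishing on a sphere is `0`,
✓`F4SubCurvatureDoorHarmonicSphere.eq_zero_of_laplacian_eq_zero_of_eval_sphere_eq_zero` — to the difference of the two expansions
on the sphere of radius `r`, then split by degree).  This file proves exactly that, kernel-free:

* `toMatrix_mulVec`, `toMatrix_mul_transpose` — the matrix `A = LinearMap.toMatrix b b R` (`b` the standard basis) of a linear
  isometry `R` of `ℝ⁴` acts by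
  `A·x = R x` and satisfies `A Aᵀ = 1`;
* `eval_bind₁_linSubst_toMatrix` — `(H ∘ A)(x) = H(R x)` for the polynomial substitution of
  ✓`Literature.Algebra.Polynomial.LaplacianOrthogonalInvariance` (which gives: `H ∘ A` is harmonic and homogeneous of the same degree);
* ★ `channel_eval_comp_eq` — under `Σ_k g_k(‖x‖²) H_k(R x) = Σ_k g_k(‖x‖²) H_k(x)` for `x ≠ 0` (harmonic homogeneous `H_k` of
  degrees `d_k`), for every degree `L`, radius `r > 0` and EVERY `y ∈ ℝ⁴`:
  `Σ_{d_k = L} g_k(r²) H_k(R y) = Σ_{d_k = L} g_k(r²) H_k(y)`.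

THEOREMS ONLY; Mathlib + tree; no `sorry`.  HONEST FRAMING: a bookkeeping brick of the build plan of an OPEN XL stub (`ChannelShellForm`);
nothing about T1″, C3, crux 23125 / 23035, rung R2d or the summit; the Yang–Mills mass gap is NOT proved.  Seat `ym-line-frs-p2` g13
(free hands), `--supports stmt-QuantumFields-23125`. [cite: AxlerBourdonRamey2001, Ch. 1 (p. 3); Thm. 5.7]
-/

set_option autoImplicit false

noncomputable section

namespace Summit.QuantumFields.YangMills.Theorems.F4SubCurvatureDoorChannelSymmetry

open MvPolynomial Matrix
open scoped BigOperators
open Literature.Algebra.Polynomial (linSubst eval_bind₁_linSubst laplacian_bind₁_linSubst_eq_zero isHomogeneous_bind₁_linSubst)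
open Summit.QuantumFields.YangMills.Theorems.F4SubCurvatureDoorHarmonicSphere (eq_zero_of_laplacian_eq_zero_of_eval_sphere_eq_zero)

/-- The matrix acts as the isometry: `A · x = R x` (coordinates). [cite: AxlerBourdonRamey2001, Ch. 1 (p. 3)] -/
theorem toMatrix_mulVec (R : EuclideanSpace ℝ (Fin 4) ≃ₗᵢ[ℝ] EuclideanSpace ℝ (Fin 4)) (x : EuclideanSpace ℝ (Fin 4)) :
    (LinearMap.toMatrix (EuclideanSpace.basisFun (Fin 4) ℝ).toBasis (EuclideanSpace.basisFun (Fin 4) ℝ).toBasis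
      (R.toLinearEquiv : EuclideanSpace ℝ (Fin 4) →ₗ[ℝ] EuclideanSpace ℝ (Fin 4))).mulVec (fun i => x i) = fun i => (R x) i := by
  have h := LinearMap.toMatrix_mulVec_repr (EuclideanSpace.basisFun (Fin 4) ℝ).toBasis
    (EuclideanSpace.basisFun (Fin 4) ℝ).toBasis (R.toLinearEquiv : EuclideanSpace ℝ (Fin 4) →ₗ[ℝ] EuclideanSpace ℝ (Fin 4)) x
  have h1 : (⇑((EuclideanSpace.basisFun (Fin 4) ℝ).toBasis.repr x) : Fin 4 → ℝ) = fun i => x i := by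
    funext i; simp
  have h2 : (⇑((EuclideanSpace.basisFun (Fin 4) ℝ).toBasis.repr ((R.toLinearEquiv : EuclideanSpace ℝ (Fin 4) →ₗ[ℝ] EuclideanSpace ℝ (Fin 4)) x)) : Fin 4 → ℝ) =
      fun i => (R x) i := by
    funext i; simp
  rw [h1, h2] at h
  exact h

/-- The matrix of a linear isometry in an orthonormal basis is orthogonal: `A Aᵀ = 1`. [cite: AxlerBourdonRamey2001, Ch. 1 (p. 3)] -/
theorem toMatrix_mul_transpose (R : EuclideanSpace ℝ (Fin 4) ≃ₗᵢ[ℝ] EuclideanSpace ℝ (Fin 4)) : (LinearMap.toMatrix (EuclideanSpace.basisFun (Fin 4) ℝ).toBasis (EuclideanSpace.basisFun (Fin 4) ℝ).toBasis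
      (R.toLinearEquiv : EuclideanSpace ℝ (Fin 4) →ₗ[ℝ] EuclideanSpace ℝ (Fin 4))) *
    (LinearMap.toMatrix (EuclideanSpace.basisFun (Fin 4) ℝ).toBasis (EuclideanSpace.basisFun (Fin 4) ℝ).toBasis
      (R.toLinearEquiv : EuclideanSpace ℝ (Fin 4) →ₗ[ℝ] EuclideanSpace ℝ (Fin 4))).transpose = 1 := by
  have h := LinearIsometryEquiv.toMatrix_mem_unitaryGroup R (EuclideanSpace.basisFun (Fin 4) ℝ)
    (EuclideanSpace.basisFun (Fin 4) ℝ)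
  rw [Matrix.mem_unitaryGroup_iff] at h
  rw [← Matrix.conjTranspose_eq_transpose_of_trivial, ← Matrix.star_eq_conjTranspose]
  exact h

/-- `(H ∘ A)(x) = H(R x)` for the polynomial substitution by the matrix of `R`. [cite: AxlerBourdonRamey2001, Ch. 1 (p. 3)] -/
theorem eval_bind₁_linSubst_toMatrix (R : EuclideanSpace ℝ (Fin 4) ≃ₗᵢ[ℝ] EuclideanSpace ℝ (Fin 4)) (x : EuclideanSpace ℝ (Fin 4)) (P : MvPolynomial (Fin 4) ℝ) :
    eval (fun i => x i) (bind₁ (linSubst (LinearMap.toMatrix (EuclideanSpace.basisFun (Fin 4) ℝ).toBasis (EuclideanSpace.basisFun (Fin 4) ℝ).toBasis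
      (R.toLinearEquiv : EuclideanSpace ℝ (Fin 4) →ₗ[ℝ] EuclideanSpace ℝ (Fin 4)))) P) = eval (fun i => (R x) i) P := by
  rw [eval_bind₁_linSubst, toMatrix_mulVec]

/-- The degree-`L` homogeneous component of a finite combination of homogeneous polynomials is the sub-sum over the terms of
degree `L`. [cite: AxlerBourdonRamey2001, Thm. 5.7] -/
theorem homogeneousComponent_sum_smul_of_isHomogeneous {ι : Type*} (s : Finset ι) (Q : ι → MvPolynomial (Fin 4) ℝ)
    (d : ι → ℕ) (c : ι → ℝ) (hQ : ∀ k, (Q k).IsHomogeneous (d k)) (L : ℕ) :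
    homogeneousComponent L (∑ k ∈ s, c k • Q k) = ∑ k ∈ s.filter (fun k => d k = L), c k • Q k := by
  rw [map_sum, Finset.sum_filter]
  refine Finset.sum_congr rfl fun k _ => ?_
  rw [map_smul, homogeneousComponent_of_mem ((mem_homogeneousSubmodule (d k) (Q k)).2 (hQ k))]
  by_cases h : d k = L
  · rw [if_pos h.symm, if_pos h]
  · rw [if_neg (Ne.symm h), if_neg h, smul_zero]

/-- ★ **Symmetry transfers to every harmonic channel** (CSF build plan C2(i)): if `Σ_k g_k(‖x‖²) H_k(R x) = Σ_k g_k(‖x‖²) H_k(x)` off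
the origin for a linear isometry `R` and harmonic homogeneous `H_k` of degrees `d_k`, then for every degree `L`, every radius `r > 0`
and every `y`: `Σ_{d_k = L} g_k(r²) H_k(R y) = Σ_{d_k = L} g_k(r²) H_k(y)`. [cite: AxlerBourdonRamey2001, Thm. 5.7] -/
theorem channel_eval_comp_eq {ι : Type*} [Fintype ι] (H : ι → MvPolynomial (Fin 4) ℝ) (d : ι → ℕ) (g : ι → ℝ → ℝ)
    (hH : ∀ k, (H k).IsHomogeneous (d k)) (hharm : ∀ k, ∑ i, pderiv i (pderiv i (H k)) = 0)
    (R : EuclideanSpace ℝ (Fin 4) ≃ₗᵢ[ℝ] EuclideanSpace ℝ (Fin 4))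
    (hsym : ∀ x : EuclideanSpace ℝ (Fin 4), x ≠ 0 →
      ∑ k, g k (‖x‖ ^ 2) * eval (fun i => (R x) i) (H k) = ∑ k, g k (‖x‖ ^ 2) * eval (fun i => x i) (H k))
    (L : ℕ) {r : ℝ} (hr : 0 < r) (y : EuclideanSpace ℝ (Fin 4)) :
    ∑ k ∈ Finset.univ.filter (fun k => d k = L), g k (r ^ 2) * eval (fun i => (R y) i) (H k) =
      ∑ k ∈ Finset.univ.filter (fun k => d k = L), g k (r ^ 2) * eval (fun i => y i) (H k) := by
  classical
  have hAA : (LinearMap.toMatrix (EuclideanSpace.basisFun (Fin 4) ℝ).toBasis (EuclideanSpace.basisFun (Fin 4) ℝ).toBasis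
      (R.toLinearEquiv : EuclideanSpace ℝ (Fin 4) →ₗ[ℝ] EuclideanSpace ℝ (Fin 4))) *
    (LinearMap.toMatrix (EuclideanSpace.basisFun (Fin 4) ℝ).toBasis (EuclideanSpace.basisFun (Fin 4) ℝ).toBasis
      (R.toLinearEquiv : EuclideanSpace ℝ (Fin 4) →ₗ[ℝ] EuclideanSpace ℝ (Fin 4))).transpose = 1 := toMatrix_mul_transpose R
  -- the difference polynomial at frozen radius `r`
  set D : ι → MvPolynomial (Fin 4) ℝ := fun k => bind₁ (linSubst (LinearMap.toMatrix (EuclideanSpace.basisFun (Fin 4) ℝ).toBasis (EuclideanSpace.basisFun (Fin 4) ℝ).toBasis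
      (R.toLinearEquiv : EuclideanSpace ℝ (Fin 4) →ₗ[ℝ] EuclideanSpace ℝ (Fin 4)))) (H k) - H k with hD
  have hDhom : ∀ k, (D k).IsHomogeneous (d k) := fun k =>
    (isHomogeneous_bind₁_linSubst _ (hH k)).sub (hH k)
  have hDharm : ∀ k, ∑ i, pderiv i (pderiv i (D k)) = 0 := by
    intro k
    simp only [hD, map_sub, Finset.sum_sub_distrib]
    rw [laplacian_bind₁_linSubst_eq_zero _ hAA (hharm k), hharm k, sub_zero]
  set Q : MvPolynomial (Fin 4) ℝ := ∑ k, g k (r ^ 2) • D k with hQ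
  -- `Q` is harmonic
  have hQharm : ∑ i, pderiv i (pderiv i Q) = 0 := by
    have : ∀ i, pderiv i (pderiv i Q) = ∑ k, g k (r ^ 2) • pderiv i (pderiv i (D k)) := by
      intro i
      simp only [hQ, map_sum, Derivation.map_smul]
    simp_rw [this]
    rw [Finset.sum_comm]
    refine Finset.sum_eq_zero fun k _ => ?_
    rw [← Finset.smul_sum, hDharm k, smul_zero]
  -- `Q` vanishes on the sphere of radius `r`
  have hQS : ∀ x : EuclideanSpace ℝ (Fin 4), ‖x‖ = r → eval (fun i => x i) Q = 0 := by
    intro x hx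
    have hx0 : x ≠ 0 := by
      intro h; rw [h, norm_zero] at hx; exact hr.ne hx
    have h := hsym x hx0
    rw [hx] at h
    simp only [hQ, hD, map_sum, smul_eval, map_sub, eval_bind₁_linSubst_toMatrix, mul_sub]
    rw [Finset.sum_sub_distrib, sub_eq_zero]
    exact h
  -- hence `Q = 0`, and so is its degree-`L` component
  have hQ0 : Q = 0 := eq_zero_of_laplacian_eq_zero_of_eval_sphere_eq_zero Q hQharm r hr hQS
  have hcomp : ∑ k ∈ Finset.univ.filter (fun k => d k = L), g k (r ^ 2) • D k = 0 := by
    rw [← homogeneousComponent_sum_smul_of_isHomogeneous Finset.univ D d (fun k => g k (r ^ 2)) hDhom L, ← hQ, hQ0,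
      map_zero]
  -- evaluate at `y`
  have h := congrArg (eval (fun i => y i)) hcomp
  simp only [map_sum, smul_eval, hD, map_sub, eval_bind₁_linSubst_toMatrix, mul_sub, map_zero,
    Finset.sum_sub_distrib, sub_eq_zero] at h
  exact h

/-! ## C2(iii) companion: restriction to the unit sphere is injective on harmonic polynomials -/

/-- **Harmonic polynomials are determined by their values on the unit sphere `S³`**: two harmonic polynomials with the same
values on `‖x‖ = 1` are equal (C1 ✓p694185 applied to the difference). [cite: AxlerBourdonRamey2001, Thm. 5.7] -/
theorem eq_of_harmonic_of_eval_sphere_eq (P Q : MvPolynomial (Fin 4) ℝ)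
    (hP : ∑ i, pderiv i (pderiv i P) = 0) (hQ : ∑ i, pderiv i (pderiv i Q) = 0)
    (h : ∀ x : EuclideanSpace ℝ (Fin 4), ‖x‖ = 1 → eval (fun i => x i) P = eval (fun i => x i) Q) : P = Q := by
  have hΔ : ∑ i, pderiv i (pderiv i (P - Q)) = 0 := by
    simp only [map_sub, Finset.sum_sub_distrib, hP, hQ, sub_zero]
  have h0 := eq_zero_of_laplacian_eq_zero_of_eval_sphere_eq_zero (P - Q) hΔ 1 one_pos fun x hx => by
    rw [map_sub, h x hx, sub_self]
  exact sub_eq_zero.1 h0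

/-- **Linear independence transfers to the restrictions to `S³`** (so `Literature.LinearAlgebra.exists_det_eval_ne_zero_of_linearIndependent`
provides unisolvent points ON THE SPHERE for any linearly independent finite family of harmonic polynomials — the point-evaluation
extraction of CSF plan C2(iii)). [cite: AxlerBourdonRamey2001, Thm. 5.7] -/
theorem linearIndependent_eval_sphere {n : ℕ} (B : Fin n → MvPolynomial (Fin 4) ℝ)
    (hB : ∀ j, ∑ i, pderiv i (pderiv i (B j)) = 0) (hli : LinearIndependent ℝ B) :
    LinearIndependent ℝ (fun j => fun ω : Metric.sphere (0 : EuclideanSpace ℝ (Fin 4)) 1 =>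
      eval (fun i => (ω : EuclideanSpace ℝ (Fin 4)) i) (B j)) := by
  rw [Fintype.linearIndependent_iff]
  intro c hc
  -- the harmonic polynomial `Σ c_j B_j` vanishes on the unit sphere, hence is `0`
  have hzero : ∑ j, c j • B j = 0 := by
    refine eq_of_harmonic_of_eval_sphere_eq _ 0 ?_ (by simp) fun x hx => ?_
    · have h1 : ∀ i, pderiv i (pderiv i (∑ j, c j • B j)) = ∑ j, c j • pderiv i (pderiv i (B j)) := by
        intro i
        simp only [map_sum, Derivation.map_smul]
      simp_rw [h1]
      rw [Finset.sum_comm]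
      refine Finset.sum_eq_zero fun j _ => ?_
      rw [← Finset.smul_sum, hB j, smul_zero]
    · have hmem : x ∈ Metric.sphere (0 : EuclideanSpace ℝ (Fin 4)) 1 := by simp [hx]
      have := congrFun hc ⟨x, hmem⟩
      simpa [Finset.sum_apply, Pi.smul_apply, smul_eval] using this
  exact fun j => Fintype.linearIndependent_iff.1 hli c hzero j

/-- **Unisolvent points on the sphere for harmonic families**: a linearly independent finite family of harmonic polynomials on `ℝ⁴`
admits points `ω_1, …, ω_n ∈ S³` with `det [B_j(ω_i)] ≠ 0`. [cite: AxlerBourdonRamey2001, Thm. 5.7] -/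
theorem exists_sphere_points_det_ne_zero {n : ℕ} (B : Fin n → MvPolynomial (Fin 4) ℝ)
    (hB : ∀ j, ∑ i, pderiv i (pderiv i (B j)) = 0) (hli : LinearIndependent ℝ B) :
    ∃ ω : Fin n → Metric.sphere (0 : EuclideanSpace ℝ (Fin 4)) 1,
      (Matrix.of fun i j => eval (fun l => (ω i : EuclideanSpace ℝ (Fin 4)) l) (B j)).det ≠ 0 :=
  Literature.LinearAlgebra.exists_det_eval_ne_zero_of_linearIndependent (linearIndependent_eval_sphere B hB hli)

end Summit.QuantumFields.YangMills.Theorems.F4SubCurvatureDoorChannelSymmetry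

end
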